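import Summits.MatrixMultiplication.MatrixMultiplication.Theorems.SoloBlindHThreeSeqLemmas

/-!
# H(3) for sequences — index-level structure of cubic representations (solo-blind, door I1⁗ / (K₃), s80)

Setting of `SoloBlindWindowTwo`: `h : ι → G` (`G` abelian of exponent `3`) zero-sum free on `S`, `τ` H-GOOD
(no sub-sum over `S` equals `τ + τ`); a MEMBER is a 3-subset `M ⊆ S` with `h`-sum `τ`
(`M ∈ soloBlindSeqRep h S 3 τ`).  By `soloBlind_twin_member_alone` (file `SoloBlindHThreeSeqLemmas`) the
interesting case is that every member is distinct-valued; members are then compared through their VALUE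
TRIPLES `M.image h ∈ soloBlindRep3 (S.image h) τ` (squarefree kernel files: two value triples share at most one
value, no value lies in three).  This file proves the index-level structure used by `SoloBlindHThreeSeq`:
* `soloBlind_swap_mem` — replacing an index of a member by a twin (same value) outside it gives a member;
* `soloBlind_common_index_twinfree` — a common index of two members with different value triples is
  twin-free (else the swap produces two disjoint members, impossible for H-good `τ`);
* `soloBlind_two_twins_alone` — a member with two twinned indices is the only value triple (another member
  passes through its third index `r`, and `{p, p₂, q, q₂} ∪ (M' \ {r})` is a zero-sum);
* `soloBlind_no_index_in_three`, `soloBlind_twinned_value_private`;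
* `soloBlind_triangle_two_twins` — three members with pairwise different value triples cannot have twinned
  indices in two of them (`{a₁, a₂} ∪ {b₁, b₂} ∪ {z, c}` has sum `5τ - 3(…) = τ + τ`).
-/

namespace Summit.MatrixMultiplication.MatrixMultiplication.Theorems

open Finset

variable {ι G : Type*} [DecidableEq ι] [AddCommGroup G] [DecidableEq G]

/-- Swapping an index of a member for a twin outside the member gives a member. -/
theorem soloBlind_swap_mem {h : ι → G} {S : Finset ι} {τ : G} {k : ℕ} {M : Finset ι}
    (hM : M ∈ soloBlindSeqRep h S k τ) {v₁ v₂ : ι} (hv₁ : v₁ ∈ M) (hv₂S : v₂ ∈ S) (hv₂M : v₂ ∉ M)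
    (htwin : h v₂ = h v₁) : insert v₂ (M.erase v₁) ∈ soloBlindSeqRep h S k τ := by
  obtain ⟨hMS, hMc, hMsum⟩ := soloBlind_mem_seqRep.mp hM
  have hv₂Q : v₂ ∉ M.erase v₁ := fun hv => hv₂M (Finset.mem_of_mem_erase hv)
  rw [soloBlind_mem_seqRep]
  refine ⟨Finset.insert_subset hv₂S ((Finset.erase_subset _ _).trans hMS), ?_, ?_⟩
  · have hpos : 0 < M.card := Finset.card_pos.mpr ⟨v₁, hv₁⟩
    rw [Finset.card_insert_of_notMem hv₂Q, Finset.card_erase_of_mem hv₁]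
    omega
  · rw [Finset.sum_insert hv₂Q, htwin, Finset.add_sum_erase M h hv₁, hMsum]

/-- Two members have a common index. -/
theorem soloBlind_common_index {h : ι → G} {S : Finset ι} {τ : G}
    (hgood : ∀ T ⊆ S, ∑ i ∈ T, h i ≠ τ + τ) {k k' : ℕ} {M M' : Finset ι}
    (hM : M ∈ soloBlindSeqRep h S k τ) (hM' : M' ∈ soloBlindSeqRep h S k' τ) : ∃ i ∈ M, i ∈ M' := by
  have hnd : ¬ Disjoint M M' := fun hd => soloBlind_hgood_not_disjoint hgood hM hM' hd
  exact Finset.not_disjoint_iff.mp hnd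

omit [DecidableEq ι] [AddCommGroup G] [DecidableEq G] in
/-- Two index sets with pointwise different values are disjoint. -/
theorem soloBlind_disjoint_of_values (h : ι → G) {A B : Finset ι} (hAB : ∀ a ∈ A, ∀ b ∈ B, h a ≠ h b) :
    Disjoint A B :=
  Finset.disjoint_left.mpr fun {w} hwA hwB => hAB w hwA w hwB rfl

section DistinctValued

variable {h : ι → G} {S : Finset ι} {τ : G}

omit [DecidableEq ι] in
/-- LINEARITY for members: two distinct-valued members with different value triples share values only at a common
index: if `i ∈ M ∩ M'` and `j ∈ M`, `j' ∈ M'` have equal values then that value is `h i`. -/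
theorem soloBlind_shared_value_eq {M M' : Finset ι}
    (hM : M ∈ soloBlindSeqRep h S 3 τ) (hM' : M' ∈ soloBlindSeqRep h S 3 τ)
    (hc : (M.image h).card = 3) (hc' : (M'.image h).card = 3) (hne : M.image h ≠ M'.image h)
    {i j j' : ι} (hiM : i ∈ M) (hiM' : i ∈ M') (hj : j ∈ M) (hj' : j' ∈ M') (hjj' : h j = h j') :
    h j = h i := by
  by_contra hji
  have hlin := soloBlind_rep3_inter_card_le_one (soloBlind_image_mem_rep3 hM hc)
    (soloBlind_image_mem_rep3 hM' hc') hne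
  have hsub : ({h j, h i} : Finset G) ⊆ M.image h ∩ M'.image h := by
    intro v hv
    simp only [Finset.mem_insert, Finset.mem_singleton] at hv
    rw [Finset.mem_inter]
    rcases hv with hv | hv
    · rw [hv]; exact ⟨Finset.mem_image_of_mem h hj, hjj' ▸ Finset.mem_image_of_mem h hj'⟩
    · rw [hv]; exact ⟨Finset.mem_image_of_mem h hiM, Finset.mem_image_of_mem h hiM'⟩
  have := Finset.card_le_card hsub
  rw [Finset.card_pair hji] at this
  omega

/-- A common index of two distinct-valued members with different value triples is twin-free (else swapping the
twin into one member produces two disjoint members). -/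
theorem soloBlind_common_index_twinfree (hgood : ∀ T ⊆ S, ∑ i ∈ T, h i ≠ τ + τ) {M M' : Finset ι}
    (hM : M ∈ soloBlindSeqRep h S 3 τ) (hM' : M' ∈ soloBlindSeqRep h S 3 τ)
    (hc : (M.image h).card = 3) (hc' : (M'.image h).card = 3) (hne : M.image h ≠ M'.image h)
    {i : ι} (hiM : i ∈ M) (hiM' : i ∈ M') {i₂ : ι} (hi₂S : i₂ ∈ S) (hi₂ : h i₂ = h i) : i₂ = i := by
  by_contra hii
  have hi₂M : i₂ ∉ M := fun hi₂M => hii (soloBlind_eq_of_value_eq hM hc hi₂M hiM hi₂)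
  have hi₂M' : i₂ ∉ M' := fun hi₂M' => hii (soloBlind_eq_of_value_eq hM' hc' hi₂M' hiM' hi₂)
  have hswap := soloBlind_swap_mem hM hiM hi₂S hi₂M hi₂
  refine soloBlind_hgood_not_disjoint hgood hswap hM' (Finset.disjoint_left.mpr ?_)
  intro w hw hwM'
  rw [Finset.mem_insert] at hw
  rcases hw with hw | hw
  · rw [hw] at hwM'; exact hi₂M' hwM'
  · have hw' := Finset.mem_erase.mp hw
    have hv : h w = h i := soloBlind_shared_value_eq hM hM' hc hc' hne hiM hiM' hw'.2 hwM' rfl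
    exact hw'.1 (soloBlind_eq_of_value_eq hM hc hw'.2 hiM hv)

/-- TWO TWINS ⟹ ALONE: if a distinct-valued member `M` has two twinned indices `p, q`, no distinct-valued member
has a different value triple. -/
theorem soloBlind_two_twins_alone (three : ∀ g : G, g + g + g = 0)
    (zsf : ∀ T ⊆ S, T.Nonempty → ∑ i ∈ T, h i ≠ 0) (hgood : ∀ T ⊆ S, ∑ i ∈ T, h i ≠ τ + τ)
    {M M' : Finset ι} (hM : M ∈ soloBlindSeqRep h S 3 τ) (hM' : M' ∈ soloBlindSeqRep h S 3 τ)
    (hc : (M.image h).card = 3) (hc' : (M'.image h).card = 3) (hne : M.image h ≠ M'.image h)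
    {p q p₂ q₂ : ι} (hp : p ∈ M) (hq : q ∈ M) (hpq : p ≠ q)
    (hp₂S : p₂ ∈ S) (hpp₂ : p₂ ≠ p) (hp₂v : h p₂ = h p)
    (hq₂S : q₂ ∈ S) (hqq₂ : q₂ ≠ q) (hq₂v : h q₂ = h q) : False := by
  obtain ⟨hMS, hMc, hMsum⟩ := soloBlind_mem_seqRep.mp hM
  obtain ⟨hM'S, hM'c, hM'sum⟩ := soloBlind_mem_seqRep.mp hM'
  obtain ⟨r, hrM, hrp, hrq, hMeq⟩ := soloBlind_triple_third hMc hp hq hpq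
  have eM : h p + (h q + h r) = τ := by
    have hs := hMsum
    rw [hMeq, soloBlind_sum_triple hpq hrp.symm hrq.symm] at hs; exact hs
  -- the common index of M and M' is twin-free, hence it is r
  obtain ⟨i, hiM, hiM'⟩ := soloBlind_common_index hgood hM hM'
  have tf := fun {i₂ : ι} (hi₂S : i₂ ∈ S) (hi₂ : h i₂ = h i) =>
    soloBlind_common_index_twinfree hgood hM hM' hc hc' hne hiM hiM' hi₂S hi₂
  have hip : i ≠ p := fun e => hpp₂ ((tf hp₂S (by rw [e]; exact hp₂v)).trans e)
  have hiq : i ≠ q := fun e => hqq₂ ((tf hq₂S (by rw [e]; exact hq₂v)).trans e)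
  have hir : i = r := by
    have hi3 : i ∈ insert p (insert q ({r} : Finset ι)) := hMeq ▸ hiM
    simp only [Finset.mem_insert, Finset.mem_singleton] at hi3
    rcases hi3 with e | e | e
    · exact absurd e hip
    · exact absurd e hiq
    · exact e
  rw [hir] at hiM'
  -- M' = {r} ∪ Q', Q' = {s, t} with values outside {h p, h q}
  have hQc : (M'.erase r).card = 2 := by rw [Finset.card_erase_of_mem hiM', hM'c]
  obtain ⟨s, t, hst, hQ⟩ := Finset.card_eq_two.mp hQc
  have hsQ : s ∈ M'.erase r := by rw [hQ]; exact Finset.mem_insert_self _ _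
  have htQ : t ∈ M'.erase r := by rw [hQ]; exact Finset.mem_insert_of_mem (Finset.mem_singleton_self _)
  have hsM' := Finset.mem_of_mem_erase hsQ
  have htM' := Finset.mem_of_mem_erase htQ
  have eQ : h s + h t = h p + h q := by
    have e := Finset.add_sum_erase M' h hiM'
    rw [hQ, Finset.sum_pair hst, hM'sum, ← eM, add_comm (h p), add_assoc] at e
    -- e : h r + (h s + h t) = h r + (h q + h p)?  normalise
    have e' : h r + (h s + h t) = h r + (h p + h q) := by rw [e]; abel
    exact add_left_cancel e'
  -- values of s, t are not h p, h q (else they would equal h r, forcing p = r or q = r)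
  have hval : ∀ w ∈ M'.erase r, h w ≠ h p ∧ h w ≠ h q := by
    intro w hw
    have hwM' := Finset.mem_of_mem_erase hw
    constructor
    · intro e
      have := soloBlind_shared_value_eq hM hM' hc hc' hne hrM hiM' hp hwM' e.symm
      exact hrp.symm (soloBlind_eq_of_value_eq hM hc hp hrM this)
    · intro e
      have := soloBlind_shared_value_eq hM hM' hc hc' hne hrM hiM' hq hwM' e.symm
      exact hrq.symm (soloBlind_eq_of_value_eq hM hc hq hrM this)
  have hpqv : h p ≠ h q := fun e => hpq (soloBlind_eq_of_value_eq hM hc hp hq e)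
  -- the zero-sum {p, p₂} ∪ {q, q₂} ∪ {s, t}
  have hd1 : Disjoint ({p, p₂} : Finset ι) {q, q₂} := by
    apply soloBlind_disjoint_of_values h
    intro a ha b hb
    simp only [Finset.mem_insert, Finset.mem_singleton] at ha hb
    have hav : h a = h p := by rcases ha with ha | ha <;> rw [ha]; exact hp₂v
    have hbv : h b = h q := by rcases hb with hb | hb <;> rw [hb]; exact hq₂v
    rw [hav, hbv]; exact hpqv
  have hd2 : Disjoint (({p, p₂} : Finset ι) ∪ {q, q₂}) (M'.erase r) := by
    apply soloBlind_disjoint_of_values h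
    intro a ha b hb
    rw [Finset.mem_union] at ha
    simp only [Finset.mem_insert, Finset.mem_singleton] at ha
    rcases ha with (ha | ha) | (ha | ha)
    · rw [ha]; exact fun e => (hval b hb).1 e.symm
    · rw [ha, hp₂v]; exact fun e => (hval b hb).1 e.symm
    · rw [ha]; exact fun e => (hval b hb).2 e.symm
    · rw [ha, hq₂v]; exact fun e => (hval b hb).2 e.symm
  have hZ : ∑ i ∈ (({p, p₂} : Finset ι) ∪ {q, q₂}) ∪ M'.erase r, h i = 0 := by
    rw [Finset.sum_union hd2, Finset.sum_union hd1, Finset.sum_pair hpp₂.symm, Finset.sum_pair hqq₂.symm, hQ,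
      Finset.sum_pair hst, hp₂v, hq₂v, eQ]
    have e3 : h p + h p + (h q + h q) + (h p + h q) = (h p + h p + h p) + (h q + h q + h q) := by abel
    rw [e3, three (h p), three (h q), add_zero]
  refine zsf _ ?_ ⟨p, ?_⟩ hZ
  · refine Finset.union_subset (Finset.union_subset ?_ ?_) ((Finset.erase_subset _ _).trans hM'S)
    · exact Finset.insert_subset (hMS hp) (Finset.singleton_subset_iff.mpr hp₂S)
    · exact Finset.insert_subset (hMS hq) (Finset.singleton_subset_iff.mpr hq₂S)
  · exact Finset.mem_union_left _ (Finset.mem_union_left _ (Finset.mem_insert_self _ _))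

omit [DecidableEq ι] in
/-- No index lies in three distinct-valued members with pairwise different value triples. -/
theorem soloBlind_no_index_in_three (three : ∀ g : G, g + g + g = 0)
    (zsf : ∀ T ⊆ S, T.Nonempty → ∑ i ∈ T, h i ≠ 0) {M₁ M₂ M₃ : Finset ι}
    (h₁ : M₁ ∈ soloBlindSeqRep h S 3 τ) (h₂ : M₂ ∈ soloBlindSeqRep h S 3 τ) (h₃ : M₃ ∈ soloBlindSeqRep h S 3 τ)
    (c₁ : (M₁.image h).card = 3) (c₂ : (M₂.image h).card = 3) (c₃ : (M₃.image h).card = 3)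
    (n₁₂ : M₁.image h ≠ M₂.image h) (n₁₃ : M₁.image h ≠ M₃.image h) (n₂₃ : M₂.image h ≠ M₃.image h)
    {i : ι} (hi₁ : i ∈ M₁) (hi₂ : i ∈ M₂) (hi₃ : i ∈ M₃) : False :=
  soloBlind_rep3_three_point (soloBlind_image_zsf_set zsf) three (soloBlind_image_mem_rep3 h₁ c₁)
    (soloBlind_image_mem_rep3 h₂ c₂) (soloBlind_image_mem_rep3 h₃ c₃) n₁₂ n₁₃ n₂₃
    (Finset.mem_image_of_mem h hi₁) (Finset.mem_image_of_mem h hi₂) (Finset.mem_image_of_mem h hi₃)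

/-- A twinned index of a member lies in no member with a different value triple, and neither does its value. -/
theorem soloBlind_twinned_value_private (hgood : ∀ T ⊆ S, ∑ i ∈ T, h i ≠ τ + τ) {M M' : Finset ι}
    (hM : M ∈ soloBlindSeqRep h S 3 τ) (hM' : M' ∈ soloBlindSeqRep h S 3 τ)
    (hc : (M.image h).card = 3) (hc' : (M'.image h).card = 3) (hne : M.image h ≠ M'.image h)
    {a₁ a₂ : ι} (ha₁ : a₁ ∈ M) (ha₂S : a₂ ∈ S) (ha₁₂ : a₂ ≠ a₁) (hav : h a₂ = h a₁) :
    ∀ w ∈ M', h w ≠ h a₁ := by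
  intro w hw e
  obtain ⟨z, hzM, hzM'⟩ := soloBlind_common_index hgood hM hM'
  have hva : h a₁ = h z := soloBlind_shared_value_eq hM hM' hc hc' hne hzM hzM' ha₁ hw e.symm
  have haz : a₁ = z := soloBlind_eq_of_value_eq hM hc ha₁ hzM hva
  have := soloBlind_common_index_twinfree hgood hM hM' hc hc' hne hzM hzM' ha₂S (by rw [hav, hva])
  exact ha₁₂ (this.trans haz.symm)

/-- TRIANGLE: three distinct-valued members with pairwise different value triples cannot have twinned indices
in two of them. -/
theorem soloBlind_triangle_two_twins (three : ∀ g : G, g + g + g = 0)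
    (zsf : ∀ T ⊆ S, T.Nonempty → ∑ i ∈ T, h i ≠ 0) (hgood : ∀ T ⊆ S, ∑ i ∈ T, h i ≠ τ + τ)
    {M₁ M₂ M₃ : Finset ι}
    (h₁ : M₁ ∈ soloBlindSeqRep h S 3 τ) (h₂ : M₂ ∈ soloBlindSeqRep h S 3 τ) (h₃ : M₃ ∈ soloBlindSeqRep h S 3 τ)
    (c₁ : (M₁.image h).card = 3) (c₂ : (M₂.image h).card = 3) (c₃ : (M₃.image h).card = 3)
    (n₁₂ : M₁.image h ≠ M₂.image h) (n₁₃ : M₁.image h ≠ M₃.image h) (n₂₃ : M₂.image h ≠ M₃.image h)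
    {a₁ a₂ b₁ b₂ : ι} (ha₁ : a₁ ∈ M₁) (ha₂S : a₂ ∈ S) (ha₁₂ : a₂ ≠ a₁) (hav : h a₂ = h a₁)
    (hb₁ : b₁ ∈ M₂) (hb₂S : b₂ ∈ S) (hb₁₂ : b₂ ≠ b₁) (hbv : h b₂ = h b₁) : False := by
  obtain ⟨h₁S, h₁c, h₁sum⟩ := soloBlind_mem_seqRep.mp h₁
  obtain ⟨h₂S, h₂c, h₂sum⟩ := soloBlind_mem_seqRep.mp h₂
  obtain ⟨h₃S, h₃c, h₃sum⟩ := soloBlind_mem_seqRep.mp h₃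
  -- private values
  have pa₂ := soloBlind_twinned_value_private hgood h₁ h₂ c₁ c₂ n₁₂ ha₁ ha₂S ha₁₂ hav
  have pa₃ := soloBlind_twinned_value_private hgood h₁ h₃ c₁ c₃ n₁₃ ha₁ ha₂S ha₁₂ hav
  have pb₁ := soloBlind_twinned_value_private hgood h₂ h₁ c₂ c₁ n₁₂.symm hb₁ hb₂S hb₁₂ hbv
  have pb₃ := soloBlind_twinned_value_private hgood h₂ h₃ c₂ c₃ n₂₃ hb₁ hb₂S hb₁₂ hbv
  -- common indices
  obtain ⟨z, hz₁, hz₂⟩ := soloBlind_common_index hgood h₁ h₂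
  obtain ⟨y, hy₁, hy₃⟩ := soloBlind_common_index hgood h₁ h₃
  obtain ⟨x, hx₂, hx₃⟩ := soloBlind_common_index hgood h₂ h₃
  have hzy : z ≠ y := fun e => soloBlind_no_index_in_three three zsf h₁ h₂ h₃ c₁ c₂ c₃ n₁₂ n₁₃ n₂₃ hz₁ hz₂ (e ▸ hy₃)
  have hzx : z ≠ x := fun e => soloBlind_no_index_in_three three zsf h₁ h₂ h₃ c₁ c₂ c₃ n₁₂ n₁₃ n₂₃ hz₁ hz₂ (e ▸ hx₃)
  have hxy : x ≠ y := fun e => soloBlind_no_index_in_three three zsf h₁ h₂ h₃ c₁ c₂ c₃ n₁₂ n₁₃ n₂₃ (e ▸ hy₁) hx₂ hx₃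
  have haz : a₁ ≠ z := fun e => pa₂ z hz₂ (by rw [e])
  have hay : a₁ ≠ y := fun e => pa₃ y hy₃ (by rw [e])
  have hbz : b₁ ≠ z := fun e => pb₁ z hz₁ (by rw [e])
  have hbx : b₁ ≠ x := fun e => pb₃ x hx₃ (by rw [e])
  -- M₁ = {a₁, z, y}, M₂ = {b₁, z, x}, M₃ = {x, y, c}
  have hM₁ : M₁ = insert a₁ (insert z {y}) := by
    symm
    apply Finset.eq_of_subset_of_card_le
    · exact Finset.insert_subset ha₁ (Finset.insert_subset hz₁ (Finset.singleton_subset_iff.mpr hy₁))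
    · rw [h₁c, Finset.card_eq_three.mpr ⟨a₁, z, y, haz, hay, hzy, rfl⟩]
  have hM₂ : M₂ = insert b₁ (insert z {x}) := by
    symm
    apply Finset.eq_of_subset_of_card_le
    · exact Finset.insert_subset hb₁ (Finset.insert_subset hz₂ (Finset.singleton_subset_iff.mpr hx₂))
    · rw [h₂c, Finset.card_eq_three.mpr ⟨b₁, z, x, hbz, hbx, hzx, rfl⟩]
  obtain ⟨c, hc₃, hcx, hcy, hM₃⟩ := soloBlind_triple_third h₃c hx₃ hy₃ hxy
  have e1 : h a₁ + (h z + h y) = τ := by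
    have hs := h₁sum; rw [hM₁, soloBlind_sum_triple haz hay hzy] at hs; exact hs
  have e2 : h b₁ + (h z + h x) = τ := by
    have hs := h₂sum; rw [hM₂, soloBlind_sum_triple hbz hbx hzx] at hs; exact hs
  have e3 : h x + (h y + h c) = τ := by
    have hs := h₃sum; rw [hM₃, soloBlind_sum_triple hxy hcx.symm hcy.symm] at hs; exact hs
  -- the value of c is outside M₁ and M₂
  have pc₁ : ∀ w ∈ M₁, h w ≠ h c := by
    intro w hw e
    have := soloBlind_shared_value_eq h₁ h₃ c₁ c₃ n₁₃ hy₁ hy₃ hw hc₃ e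
    have hcyv : h c = h y := by rw [← e, this]
    exact hcy (soloBlind_eq_of_value_eq h₃ c₃ hc₃ hy₃ hcyv)
  have pc₂ : ∀ w ∈ M₂, h w ≠ h c := by
    intro w hw e
    have := soloBlind_shared_value_eq h₂ h₃ c₂ c₃ n₂₃ hx₂ hx₃ hw hc₃ e
    have hcxv : h c = h x := by rw [← e, this]
    exact hcx (soloBlind_eq_of_value_eq h₃ c₃ hc₃ hx₃ hcxv)
  -- the set {a₁, a₂} ∪ {b₁, b₂} ∪ {z, c} has sum τ + τ
  have hd1 : Disjoint ({a₁, a₂} : Finset ι) {b₁, b₂} := by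
    apply soloBlind_disjoint_of_values h
    intro a ha b hb
    simp only [Finset.mem_insert, Finset.mem_singleton] at ha hb
    have hav' : h a = h a₁ := by rcases ha with ha | ha <;> rw [ha]; exact hav
    have hbv' : h b = h b₁ := by rcases hb with hb | hb <;> rw [hb]; exact hbv
    rw [hav', hbv']
    exact fun e => pa₂ b₁ hb₁ e.symm
  have hzc : z ≠ c := fun e => pc₁ z hz₁ (by rw [e])
  have hd2 : Disjoint (({a₁, a₂} : Finset ι) ∪ {b₁, b₂}) {z, c} := by
    apply soloBlind_disjoint_of_values h
    intro a ha b hb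
    rw [Finset.mem_union] at ha
    simp only [Finset.mem_insert, Finset.mem_singleton] at ha hb
    rcases hb with hb | hb
    · rw [hb]
      rcases ha with (ha | ha) | (ha | ha)
      · rw [ha]; exact fun e => pa₂ z hz₂ e.symm
      · rw [ha, hav]; exact fun e => pa₂ z hz₂ e.symm
      · rw [ha]; exact fun e => pb₁ z hz₁ e.symm
      · rw [ha, hbv]; exact fun e => pb₁ z hz₁ e.symm
    · rw [hb]
      rcases ha with (ha | ha) | (ha | ha)
      · rw [ha]; exact pc₁ a₁ ha₁
      · rw [ha, hav]; exact pc₁ a₁ ha₁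
      · rw [ha]; exact pc₂ b₁ hb₁
      · rw [ha, hbv]; exact pc₂ b₁ hb₁
  have hZ : ∑ i ∈ (({a₁, a₂} : Finset ι) ∪ {b₁, b₂}) ∪ {z, c}, h i = τ + τ := by
    rw [Finset.sum_union hd2, Finset.sum_union hd1, Finset.sum_pair ha₁₂.symm, Finset.sum_pair hb₁₂.symm,
      Finset.sum_pair hzc, hav, hbv]
    have e5 : h a₁ + h a₁ + (h b₁ + h b₁) + (h z + h c) =
        (h a₁ + (h z + h y)) + (h a₁ + (h z + h y)) + (h b₁ + (h z + h x)) + (h b₁ + (h z + h x)) +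
          (h x + (h y + h c)) - (h z + h z + h z) - (h y + h y + h y) - (h x + h x + h x) := by abel
    rw [e5, e1, e2, e3, three (h z), three (h y), three (h x), sub_zero, sub_zero, sub_zero]
    have e6 : τ + τ + τ + τ + τ = τ + τ + (τ + τ + τ) := by abel
    rw [e6, three τ, add_zero]
  refine hgood _ ?_ hZ
  refine Finset.union_subset (Finset.union_subset ?_ ?_) ?_
  · exact Finset.insert_subset (h₁S ha₁) (Finset.singleton_subset_iff.mpr ha₂S)
  · exact Finset.insert_subset (h₂S hb₁) (Finset.singleton_subset_iff.mpr hb₂S)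
  · exact Finset.insert_subset (h₁S hz₁) (Finset.singleton_subset_iff.mpr (h₃S hc₃))

end DistinctValued

end Summit.MatrixMultiplication.MatrixMultiplication.Theorems
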